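import Summits.AtomisticToContinuum.HydrodynamicLimit.Theorems.InformationPercolationEnginePercolationClosesChaosDockingCells
import Summits.AtomisticToContinuum.HydrodynamicLimit.Theorems.InformationPercolationEnginePercolationClosesChaosDockingOwners
import HarnessLib

/-!
# Forecast transfer S6 of the line `equilibrium-forecast-chain-rule` (crux `InformationPercolationEngine.PercolationClosesChaos`,
stmt-AtomisticToContinuum-15178) — piece E: the lexicographic enumeration of the kinetic cells and of the unit stages

Support file (`--supports stmt-AtomisticToContinuum-15178`) of the registered stub `stub_forecastTransfer` (worker S6 of lead
c3), equally consumed by S5 (`stub_cesaroLocalEquilibrium`). The engine `PredictableProjection` runs along ONE sequence of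
stages `n = 0, 1, 2, …`; the line's units are pairs (step `k`, cell `q` of the finite box `cellBox h`, `h = cℓ_N`) revealed in
increasing lexicographic order `cellLT` inside each step. This file fixes the dictionary, with NO choice of representatives
beyond the order itself:

* `cellLT_irrefl`, `cellLT_trans` — with `cellLT_asymm`, `cellLT_total` (piece C of the docking) `cellLT` is a strict total order;
* `cellRank h q = #{p ∈ cellBox h | p <ₗₑₓ q}` — the rank of a cell in the box: `cellRank_lt_card`, `cellLT_iff_cellRank_lt`,
  `not_cellLT_iff_cellRank_le`, `cellRank_injOn`, `exists_cellRank_eq` (a bijection `cellBox h → {0, …, M − 1}`, `M = #cellBox h`);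
* `nthCell h j` — its inverse (`nthCell_cellRank`, `cellRank_nthCell`, `nthCell_mem_cellBox`);
* `zero_mem_cellBox`, `card_cellBox_pos`;
* the stage of unit `(k, q)` is `k · M + cellRank h q`: `stage_div`, `stage_mod`, `stage_lt_iff`, and the registered headline
  `sum_range_mul_card_cellBox` — a sum over the first `K · M` stages is the double sum over steps `k < K` and cells of the box.
-/

noncomputable section

open MeasureTheory Set Filter Topology
open scoped ENNReal BigOperators Classical
open Literature.Analysis.FluidPDE Literature.MathematicalPhysics.KineticTheory
open Literature.MathematicalPhysics.KineticTheory.VelocityBlindPlacement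

namespace Summit.AtomisticToContinuum.HydrodynamicLimit.Theorems.EquilibriumForecastLine

/-! ## The strict total order `cellLT` -/

/-- `cellLT` is irreflexive. [folklore] -/
theorem cellLT_irrefl (p : Cell) : ¬ cellLT p p := by
  unfold cellLT; omega

/-- `cellLT` is transitive. [folklore] -/
theorem cellLT_trans {p q r : Cell} (h₁ : cellLT p q) (h₂ : cellLT q r) : cellLT p r := by
  unfold cellLT at h₁ h₂ ⊢; omega

/-! ## The box -/

/-- The origin cell lies in the box (`0 < h`). [folklore] -/
theorem zero_mem_cellBox {h : ℝ} (hh : 0 < h) : (0 : Cell) ∈ cellBox h := by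
  rw [cellBox, Fintype.mem_piFinset]
  intro m
  rw [Finset.mem_Icc, Pi.zero_apply]
  refine ⟨Int.floor_nonpos (div_nonpos_of_nonpos_of_nonneg (by norm_num) hh.le), Int.floor_nonneg.2 (by positivity)⟩

/-- The box is nonempty: `0 < #cellBox h` (`0 < h`). [folklore] -/
theorem card_cellBox_pos {h : ℝ} (hh : 0 < h) : 0 < (cellBox h).card :=
  Finset.card_pos.2 ⟨0, zero_mem_cellBox hh⟩

/-! ## The rank of a cell in the box -/

/-- RANK of a cell in the box: the number of cells of the box lexicographically below it. -/
def cellRank (h : ℝ) (q : Cell) : ℕ := ((cellBox h).filter fun p => cellLT p q).card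

/-- The rank of a cell of the box is `< #cellBox h`. [folklore] -/
theorem cellRank_lt_card {h : ℝ} {q : Cell} (hq : q ∈ cellBox h) : cellRank h q < (cellBox h).card := by
  refine Finset.card_lt_card ⟨Finset.filter_subset _ _, fun hsub => ?_⟩
  exact cellLT_irrefl q (Finset.mem_filter.1 (hsub hq)).2

/-- The rank is strictly increasing along `cellLT` (first argument in the box). [folklore] -/
theorem cellRank_lt_of_cellLT {h : ℝ} {p q : Cell} (hp : p ∈ cellBox h) (hpq : cellLT p q) :
    cellRank h p < cellRank h q := by
  refine Finset.card_lt_card ⟨fun r hr => ?_, fun hsub => ?_⟩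
  · rw [Finset.mem_filter] at hr ⊢
    exact ⟨hr.1, cellLT_trans hr.2 hpq⟩
  · exact cellLT_irrefl p (Finset.mem_filter.1 (hsub (Finset.mem_filter.2 ⟨hp, hpq⟩))).2

/-- **On the box, `cellLT` is the order of ranks.** [folklore] -/
theorem cellLT_iff_cellRank_lt {h : ℝ} {p q : Cell} (hp : p ∈ cellBox h) (hq : q ∈ cellBox h) :
    cellLT p q ↔ cellRank h p < cellRank h q := by
  refine ⟨cellRank_lt_of_cellLT hp, fun hlt => ?_⟩
  by_contra hn
  rcases eq_or_ne p q with rfl | hne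
  · exact lt_irrefl _ hlt
  · rcases cellLT_total hne with h' | h'
    · exact hn h'
    · exact lt_asymm hlt (cellRank_lt_of_cellLT hq h')

/-- On the box, `¬ q <ₗₑₓ p ↔ rank p ≤ rank q`. [folklore] -/
theorem not_cellLT_iff_cellRank_le {h : ℝ} {p q : Cell} (hp : p ∈ cellBox h) (hq : q ∈ cellBox h) :
    ¬ cellLT q p ↔ cellRank h p ≤ cellRank h q := by
  rw [cellLT_iff_cellRank_lt hq hp, not_lt]

/-- The rank is injective on the box. [folklore] -/
theorem cellRank_injOn (h : ℝ) : Set.InjOn (cellRank h) (cellBox h) := by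
  intro p hp q hq hpq
  by_contra hne
  rcases cellLT_total hne with h' | h'
  · exact (cellRank_lt_of_cellLT hp h').ne hpq
  · exact (cellRank_lt_of_cellLT hq h').ne hpq.symm

/-- On the box, equal ranks means equal cells. [folklore] -/
theorem cellRank_eq_iff {h : ℝ} {p q : Cell} (hp : p ∈ cellBox h) (hq : q ∈ cellBox h) :
    cellRank h p = cellRank h q ↔ p = q :=
  ⟨fun hpq => cellRank_injOn h hp hq hpq, fun hpq => by rw [hpq]⟩

/-- **The rank is onto `{0, …, M − 1}`**: every `j < #cellBox h` is the rank of a cell of the box. [folklore] -/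
theorem exists_cellRank_eq {h : ℝ} {j : ℕ} (hj : j < (cellBox h).card) : ∃ q ∈ cellBox h, cellRank h q = j := by
  obtain ⟨q, hq, hqj⟩ := Finset.surj_on_of_inj_on_of_card_le (s := cellBox h) (t := Finset.range (cellBox h).card)
    (fun q _ => cellRank h q) (fun q hq => Finset.mem_range.2 (cellRank_lt_card hq))
    (fun p q hp hq hpq => cellRank_injOn h hp hq hpq) (by simp) j (Finset.mem_range.2 hj)
  exact ⟨q, hq, hqj.symm⟩

/-! ## The `j`-th cell of the box -/

/-- The `j`-th cell of the box in lexicographic order (the inverse of `cellRank h` on the box; junk off `j < #cellBox h`). -/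
def nthCell (h : ℝ) (j : ℕ) : Cell := Function.invFunOn (cellRank h) (cellBox h : Set Cell) j

/-- `nthCell` inverts the rank on the box. [folklore] -/
theorem nthCell_cellRank {h : ℝ} {q : Cell} (hq : q ∈ cellBox h) : nthCell h (cellRank h q) = q :=
  (cellRank_injOn h).leftInvOn_invFunOn hq

/-- The `j`-th cell lies in the box (`j < #cellBox h`). [folklore] -/
theorem nthCell_mem_cellBox {h : ℝ} {j : ℕ} (hj : j < (cellBox h).card) : nthCell h j ∈ cellBox h := by
  obtain ⟨q, hq, hqj⟩ := exists_cellRank_eq hj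
  exact Function.invFunOn_mem ⟨q, Finset.mem_coe.2 hq, hqj⟩

/-- The rank of the `j`-th cell is `j` (`j < #cellBox h`). [folklore] -/
theorem cellRank_nthCell {h : ℝ} {j : ℕ} (hj : j < (cellBox h).card) : cellRank h (nthCell h j) = j := by
  obtain ⟨q, hq, hqj⟩ := exists_cellRank_eq hj
  exact Function.invFunOn_eq ⟨q, Finset.mem_coe.2 hq, hqj⟩

/-! ## Stages -/

/-- The step of stage `k · M + rank q` is `k`. [folklore] -/
theorem stage_div {h : ℝ} {q : Cell} (hq : q ∈ cellBox h) (k : ℕ) :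
    (k * (cellBox h).card + cellRank h q) / (cellBox h).card = k := by
  have hM : 0 < (cellBox h).card := Finset.card_pos.2 ⟨q, hq⟩
  rw [Nat.add_comm, Nat.add_mul_div_right _ _ hM, Nat.div_eq_of_lt (cellRank_lt_card hq), Nat.zero_add]

/-- The in-step index of stage `k · M + rank q` is `rank q`. [folklore] -/
theorem stage_mod {h : ℝ} {q : Cell} (hq : q ∈ cellBox h) (k : ℕ) :
    (k * (cellBox h).card + cellRank h q) % (cellBox h).card = cellRank h q := by
  rw [Nat.add_comm, Nat.add_mul_mod_self_right, Nat.mod_eq_of_lt (cellRank_lt_card hq)]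

/-- The stage of a unit recovers the unit: `nthCell` of the in-step index. [folklore] -/
theorem nthCell_stage_mod {h : ℝ} {q : Cell} (hq : q ∈ cellBox h) (k : ℕ) :
    nthCell h ((k * (cellBox h).card + cellRank h q) % (cellBox h).card) = q := by
  rw [stage_mod hq, nthCell_cellRank hq]

/-- **Stages are ordered lexicographically**: `(k, q)` comes before `(k', q')` iff `k < k'`, or `k = k'` and `q <ₗₑₓ q'`.
[folklore] -/
theorem stage_lt_iff {h : ℝ} {q q' : Cell} (hq : q ∈ cellBox h) (hq' : q' ∈ cellBox h) (k k' : ℕ) :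
    k * (cellBox h).card + cellRank h q < k' * (cellBox h).card + cellRank h q' ↔
      k < k' ∨ (k = k' ∧ cellLT q q') := by
  rw [cellLT_iff_cellRank_lt hq hq']
  have h1 := cellRank_lt_card hq
  have h2 := cellRank_lt_card hq'
  set M := (cellBox h).card
  constructor
  · intro hlt
    rcases lt_trichotomy k k' with hk | rfl | hk
    · exact Or.inl hk
    · exact Or.inr ⟨rfl, by omega⟩
    · exfalso
      have : k' * M + M ≤ k * M := by nlinarith
      omega
  · rintro (hk | ⟨rfl, hr⟩)
    · have : k * M + M ≤ k' * M := by nlinarith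
      omega
    · omega

/-- Distinct units have distinct stages. [folklore] -/
theorem stage_injective {h : ℝ} {q q' : Cell} (hq : q ∈ cellBox h) (hq' : q' ∈ cellBox h) {k k' : ℕ}
    (he : k * (cellBox h).card + cellRank h q = k' * (cellBox h).card + cellRank h q') : k = k' ∧ q = q' := by
  have hk : k = k' := by
    have h1 := stage_div hq k
    have h2 := stage_div hq' k'
    rw [he] at h1
    exact h1.symm.trans h2
  subst hk
  exact ⟨rfl, (cellRank_eq_iff hq hq').1 (by omega)⟩

/-! ## Sums over stages -/

/-- A sum over in-step indices `j < M` is the sum over the cells of the box through the rank. [folklore] -/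
theorem sum_range_card_cellBox {β : Type*} [AddCommMonoid β] (h : ℝ) (f : ℕ → β) :
    ∑ j ∈ Finset.range (cellBox h).card, f j = ∑ q ∈ cellBox h, f (cellRank h q) := by
  refine (Finset.sum_nbij' (fun q => cellRank h q) (fun j => nthCell h j) (fun q hq => ?_) (fun j hj => ?_)
    (fun q hq => ?_) (fun j hj => ?_) (fun q _ => rfl)).symm
  · exact Finset.mem_range.2 (cellRank_lt_card hq)
  · exact nthCell_mem_cellBox (Finset.mem_range.1 hj)
  · exact nthCell_cellRank hq
  · exact cellRank_nthCell (Finset.mem_range.1 hj)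

/-- **Registered helper `sum_range_mul_card_cellBox` (piece E of S5/S6): a sum over the first `K · M` stages is the double sum
over steps `k < K` and cells `q` of the box at stage `k · M + cellRank h q`** (`M = #cellBox h`; the dictionary between the
engine's one sequence of increments and the line's unit sums). [folklore] -/
theorem sum_range_mul_card_cellBox : ∀ (h : ℝ) (K : ℕ) (f : ℕ → ℝ), ∑ n ∈ Finset.range (K * (cellBox h).card), f n = ∑ k ∈ Finset.range K, ∑ q ∈ cellBox h, f (k * (cellBox h).card + cellRank h q) := by
  intro h K f
  induction K with
  | zero => simp
  | succ K ih =>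
    rw [Nat.succ_mul, Finset.sum_range_add, ih, Finset.sum_range_succ, sum_range_card_cellBox]

end Summit.AtomisticToContinuum.HydrodynamicLimit.Theorems.EquilibriumForecastLine

end
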